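import Summits.QuantumFields.YangMills.Theorems.ParabolicTrajectoryContinuumLimitOnTrajectoryDefs

/-!
# Stub `stub_osLegs` (line `two-orbit-synchronisation`), part C: E0-hermiticity from E2 (general lemma on labelled
Schwinger families, Kravchuk–Qiao–Rychkov Rem. 2.2) and the zero-extension of a one-field family to all species
-/


set_option autoImplicit false

open scoped SchwartzMap
open MeasureTheory Filter Topology
open Literature.MathematicalPhysics.QuantumFieldTheory Literature.MathematicalPhysics.QuantumLattice
open Literature.MathematicalPhysics.AQFT Literature.Probability.LatticeModels
open Summit.QuantumFields.YangMills.Theses.ParabolicTrajectory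

noncomputable section

namespace Summit.QuantumFields.YangMills.Cruxes.ContinuumLimitOnTrajectory.TwoOrbitSynchronisation

local notation "𝔼" => EuclideanSpace ℝ (Fin 4)

/-! ## §F  E0-hermiticity from E2 + E0-normalisation (Kravchuk–Qiao–Rychkov 2021, Remark 2.2) — a general lemma
on labelled Schwinger families (candidate tree lemma; class (i), proved) -/

section HermitianOfRP

variable {ι : Type} {d : ℕ} [NeZero d]

omit [NeZero d] in
/-- Transport of a labelled family along an equality of degrees (`Fin (0 + n)` vs `Fin n` bookkeeping). -/
theorem apply_cast_eq (S : LabelledSchwingerFamily ι (EuclideanSpace ℝ (Fin d))) {p q : ℕ} (h : p = q)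
    (σ : Fin q → ι) (H : 𝓢((Fin p → EuclideanSpace ℝ (Fin d)), ℂ)) (H' : 𝓢((Fin q → EuclideanSpace ℝ (Fin d)), ℂ))
    (hH : ∀ x, H x = H' (fun i => x (Fin.cast h.symm i))) :
    S p (σ ∘ Fin.cast h) H = S q σ H' := by
  subst h
  have hHH : H = H' := by
    ext x
    rw [hH x]
    simp
  rw [hHH]
  rfl

/-- Every `0`-point test function is time-ordered (both conditions are vacuous). -/
theorem isTimeOrdered_of_zero (E : 𝓢((Fin 0 → EuclideanSpace ℝ (Fin d)), ℂ)) : IsTimeOrdered E :=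
  fun _ _ => ⟨fun i => i.elim0, fun i => i.elim0⟩

/-- The degrees `(n, 0)` of the two-term family. -/
def deg2 (n : ℕ) : Fin 2 → ℕ := ![n, 0]

/-- The label strings `(k, ∅)` of the two-term family (dependent pattern matching on the index literal). -/
def lab2 {n : ℕ} (k : Fin n → ι) : (j : Fin 2) → Fin (deg2 n j) → ι
  | ⟨0, _⟩ => k
  | ⟨1, _⟩ => Fin.elim0

/-- The test functions `(F, E)` of the two-term family. -/
def fam2 {n : ℕ} (F : 𝓢((Fin n → EuclideanSpace ℝ (Fin d)), ℂ)) (E : 𝓢((Fin 0 → EuclideanSpace ℝ (Fin d)), ℂ)) :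
    (j : Fin 2) → 𝓢((Fin (deg2 n j) → EuclideanSpace ℝ (Fin d)), ℂ)
  | ⟨0, _⟩ => F
  | ⟨1, _⟩ => E

/-- **E2 ⇒ E0-hermiticity** on time-ordered test functions: apply reflection positivity to the two-term
families `(F ; c · 1₀)` (degrees `n` and `0`), `c ∈ {0, 1, i}`; the imaginary parts of the `2 × 2` sums give
`𝔖ₙ^{k}(F) = conj 𝔖ₙ^{rev k}(θF*)`. [Kravchuk–Qiao–Rychkov 2021, Remark 2.2] -/
theorem isHermitian_of_isReflectionPositive (S : LabelledSchwingerFamily ι (EuclideanSpace ℝ (Fin d)))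
    (h2 : S.IsReflectionPositive) (h0 : S.IsNormalized) : S.IsHermitian := by
  intro n k F hF
  set β := S n (k ∘ Fin.rev) (osAdjoint F) with hβ
  set γ := S n k F with hγ
  set A := S (n + n) (Fin.append (k ∘ Fin.rev) k) (SchwartzMap.appendTensor (osAdjoint F) F) with hA
  -- the RP sum of the two-term family with constant `c` in the degree-0 slot
  have key : ∀ c : ℂ, (A + c * β + ((starRingEnd ℂ) c * γ + (starRingEnd ℂ) c * c)).im = 0 := by
    intro c
    let E : 𝓢((Fin 0 → EuclideanSpace ℝ (Fin d)), ℂ) := c • SchwartzMap.constOfSubsingleton 1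
    have hE : ∀ x, E x = c := fun x => by
      simp [E, SchwartzMap.constOfSubsingleton_apply]
    have hfam : ∀ j, IsTimeOrdered (fam2 F E j) := by
      intro j
      match j with
      | ⟨0, _⟩ => exact hF
      | ⟨1, _⟩ => exact isTimeOrdered_of_zero E
    have h := (h2 2 (deg2 n) (lab2 k) (fam2 F E) hfam
      (fun i j => SchwartzMap.appendTensor (osAdjoint (fam2 F E i)) (fam2 F E j))
      (fun i j => isAppendTensorOf_appendTensor _ _)).2
    simp only [Fin.sum_univ_two] at h
    -- identify the four terms
    have e00 : S (deg2 n 0 + deg2 n 0) (Fin.append (lab2 k 0 ∘ Fin.rev) (lab2 k 0))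
        (SchwartzMap.appendTensor (osAdjoint (fam2 F E 0)) (fam2 F E 0)) = A := rfl
    have e01 : S (deg2 n 0 + deg2 n 1) (Fin.append (lab2 k 0 ∘ Fin.rev) (lab2 k 1))
        (SchwartzMap.appendTensor (osAdjoint (fam2 F E 0)) (fam2 F E 1)) = c * β := by
      show S (n + 0) (Fin.append (k ∘ Fin.rev) Fin.elim0) (SchwartzMap.appendTensor (osAdjoint F) E) = c * β
      rw [Fin.append_elim0, apply_cast_eq S (Nat.add_zero n) (k ∘ Fin.rev) _ (c • osAdjoint F), map_smul,
        smul_eq_mul]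
      intro x
      rw [SchwartzMap.appendTensor_apply, hE, smul_apply, smul_eq_mul, mul_comm]
      rfl
    have e10 : S (deg2 n 1 + deg2 n 0) (Fin.append (lab2 k 1 ∘ Fin.rev) (lab2 k 0))
        (SchwartzMap.appendTensor (osAdjoint (fam2 F E 1)) (fam2 F E 0)) = (starRingEnd ℂ) c * γ := by
      show S (0 + n) (Fin.append (Fin.elim0 ∘ Fin.rev) k) (SchwartzMap.appendTensor (osAdjoint E) F) = _
      have h1 : (Fin.elim0 ∘ Fin.rev : Fin 0 → ι) = Fin.elim0 := funext fun i => i.elim0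
      rw [h1, Fin.elim0_append, apply_cast_eq S (Nat.zero_add n) k _ ((starRingEnd ℂ) c • F), map_smul,
        smul_eq_mul]
      intro x
      rw [SchwartzMap.appendTensor_apply, osAdjoint_apply, hE, smul_apply, smul_eq_mul]
      congr 1
      congr 1
      funext i
      simp only [Function.comp_apply]
      congr 1
      exact Fin.ext (by simp)
    have e11 : S (deg2 n 1 + deg2 n 1) (Fin.append (lab2 k 1 ∘ Fin.rev) (lab2 k 1))
        (SchwartzMap.appendTensor (osAdjoint (fam2 F E 1)) (fam2 F E 1)) = (starRingEnd ℂ) c * c := by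
      show S 0 (Fin.append (Fin.elim0 ∘ Fin.rev) Fin.elim0) (SchwartzMap.appendTensor (osAdjoint E) E) = _
      rw [h0, SchwartzMap.appendTensor_apply, osAdjoint_apply, hE, hE]
    rw [e00, e01, e10, e11] at h
    exact h
  -- read off `γ = conj β` from `c = 0, 1, i`
  have k0 := key 0
  have k1 := key 1
  have kI := key Complex.I
  simp only [zero_mul, map_zero, add_zero] at k0
  simp only [one_mul, map_one, mul_one, Complex.add_im, Complex.one_im, k0] at k1
  simp only [Complex.conj_I, Complex.add_im, Complex.mul_im, Complex.I_re, Complex.I_im, Complex.neg_re,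
    Complex.neg_im, k0] at kI
  apply Complex.ext
  · simp only [Complex.conj_re]; linarith
  · simp only [Complex.conj_im]; linarith

/-- **Registered representative of this file** (closed form of `isHermitian_of_isReflectionPositive`, for the
gate's `--supports` stub check): E2 + E0-normalisation ⇒ E0-hermiticity. -/
theorem osLegsC_isHermitian_of_isReflectionPositive :
    ∀ {ι : Type} {d : ℕ} [NeZero d] (S : LabelledSchwingerFamily ι (EuclideanSpace ℝ (Fin d))),
      S.IsReflectionPositive → S.IsNormalized → S.IsHermitian := by
  intro ι d _ S h2 h0
  exact isHermitian_of_isReflectionPositive S h2 h0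

end HermitianOfRP

/-! ## §G  The zero-extension of a one-field family to all species -/

section ZeroExt

variable {G : Type} [Group G] [TopologicalSpace G] [IsTopologicalGroup G] [CompactSpace G]
  [MeasurableSpace G] [BorelSpace G]

open Classical in
/-- Zero-extension: the curvature string carries `Λ p`, every other label string the zero distribution. -/
def zeroExt (r : LatticeRep G) (Λ : (p : ℕ) → 𝓢((Fin p → 𝔼), ℂ) →L[ℂ] ℂ) :
    LabelledSchwingerFamily (YMSpecies G) 𝔼 :=
  fun p σ => if σ = fun _ => r.curvature then Λ p else 0

variable (r : LatticeRep G) (Λ : (p : ℕ) → 𝓢((Fin p → 𝔼), ℂ) →L[ℂ] ℂ)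

/-- On the curvature string the zero-extension is `Λ p`. -/
@[simp] theorem zeroExt_curv (p : ℕ) : zeroExt r Λ p (fun _ => r.curvature) = Λ p := by
  simp [zeroExt]

/-- Off the curvature string the zero-extension vanishes. -/
theorem zeroExt_of_ne {p : ℕ} {σ : Fin p → YMSpecies G} {i : Fin p} (hi : σ i ≠ r.curvature) :
    zeroExt r Λ p σ = 0 := by
  unfold zeroExt
  rw [if_neg]
  exact fun h => hi (congrFun h i)

/-- Appending two curvature strings gives the curvature string. -/
theorem append_curv (n m : ℕ) :
    Fin.append ((fun _ : Fin n => r.curvature) ∘ Fin.rev) (fun _ : Fin m => r.curvature) =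
      fun _ : Fin (n + m) => r.curvature := by
  funext i
  induction i using Fin.addCases with
  | left i => simp
  | right i => simp

/-- An appended string with a non-curvature label on the left is not the curvature string. -/
theorem zeroExt_append_of_ne_left {n m : ℕ} {k : Fin n → YMSpecies G} (k' : Fin m → YMSpecies G) {i : Fin n}
    (hi : k i ≠ r.curvature) : zeroExt r Λ (n + m) (Fin.append (k ∘ Fin.rev) k') = 0 :=
  zeroExt_of_ne r Λ (i := Fin.castAdd m (Fin.rev i)) (by simpa using hi)

/-- The same on the right. -/
theorem zeroExt_append_of_ne_right {n m : ℕ} (k : Fin n → YMSpecies G) {k' : Fin m → YMSpecies G} {j : Fin m}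
    (hj : k' j ≠ r.curvature) : zeroExt r Λ (n + m) (Fin.append (k ∘ Fin.rev) k') = 0 :=
  zeroExt_of_ne r Λ (i := Fin.natAdd n j) (by simpa using hj)

end ZeroExt


end Summit.QuantumFields.YangMills.Cruxes.ContinuumLimitOnTrajectory.TwoOrbitSynchronisation

end
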